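import Summits.CriticalPhenomena.PercolationContinuityZ3.Theorems.PercNearOneGluingNoHeavyQuantAtomLightSlice
import Summits.CriticalPhenomena.PercolationContinuityZ3.Theorems.PercNearOneGluingNoHeavyQuantConvTopDatum
import Summits.CriticalPhenomena.PercolationContinuityZ3.Theorems.PercNearOneGluingNoHeavyQuantWindowWitness
import HarnessLib

/-!
# QUANT lane R8, T-DEC: THE TRIVIAL SIDE OF THE EXPLICIT RESIDUE — an atom pair whose cheap low is NOT DEEP convolves to a DEC law
# (census-2 g58; census-1 g21's raised-target criterion for the explicit atoms: `ConvClosedTAtomsOrd` is reduced to its DOUBLY DEEP part)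

builds on p205010 (kernel theorem, internal audit signed; external expert review pending)

Support file (`--supports stmt-CriticalPhenomena-4575`), QUANT lane seat prim-quant-census-2 (gen 58), rung R8 of
`run/shared/lean/prim/quant/LADDER.md`.  Theorems only, standard axioms, no sorries.  Memo `…/prim-quant-census-2-g58/EXTREME-ATOMS-G58.md` §3.

* `atomLaw_split` (low part + absorber part), indicator sums.
* **`atomLaw_decAtT_allGiant`** — admissible data, a layer `J` below both absorbers (`J < h₁`, `J < h₂`) and any target `T′ ≥ T`: the atom is DEC at
  `(T′, J)` — no mid carries mass, the lows carry at most `1 − x`, the giants at least `x = u(1 − x)` (`decAtT_iff_of_noMid`, census-2 g57).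
* **`lconv_atoms_decAtT_of_not_deep`** (+ mirror `…'`) — for admissible data on both sides, the second atom window-DEC on `[j − M₁, j]` with ordered
  absorbers `h₂′ ≤ h₂`, and `j < l₁′ + h₂′` (the cheap low of the first atom is not deep w.r.t. the second): the convolution of the two atoms is DEC at
  `(T₁ + T₂, j)`.  Proof: the light slice of side 1 is `(1−γ)·shift_{l₁′} + γ·shift_{h₁′}` of the second atom (`lconv_TP`); its `l₁′`-copy reads the second
  atom at the raised target `T₁ + T₂ − 2l₁′` at the layer `j − l₁′ < h₂′ ≤ h₂` (`atomLaw_decAtT_allGiant`), its `h₁′`-copy at the window layer `j − h₁′`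
  (`shift_lightPair_decAtT_of_higherTarget`, census-1 g21); then `lconv_atomLaw_decAtT_of_lightSlice`.  CONSEQUENCE: `ConvClosedTAtomsOrd` only needs the
  DOUBLY DEEP pairs `l₁′ + h₂′ ≤ j ∧ l₂′ + h₁′ ≤ j` (census-1 g21 §3 (a): 245 / 387 residue pairs at M ≤ 5 have no trivial side).

[this work]; nothing here is cited as a published result.  The gluing rows served [cite: KozmaNitzan2024, Conjecture 3 (p. 15)]; product
measure [cite: Grimmett1999, §1.3 p. 10].
-/

noncomputable section

namespace Summit.CriticalPhenomena.PercolationContinuityZ3.Theorems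

namespace Quant

open Finset

/-- the two-point law `{lo, hi; g}` (as in `…QuantLawDEC`) -/
local notation3 "TP[" lo ", " hi ", " g ", " h "]" =>
  (g : ℝ) * (if (h : ℕ) = (hi : ℕ) then (1 : ℝ) else 0) + (1 - (g : ℝ)) * (if (h : ℕ) = (lo : ℕ) then (1 : ℝ) else 0)

/-- the shifted law `μ(· − s)` (as in `…QuantConvTopDatum`) -/
local notation3 "SH[" μ ", " s ", " h "]" => (if (s : ℕ) ≤ (h : ℕ) then (μ : ℕ → ℝ) ((h : ℕ) - (s : ℕ)) else (0 : ℝ))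

namespace LawDec

/-- indicator of equality of naturals, as a real number -/
local notation3 "𝟙[" a ", " b "]" => (if (a : ℕ) = (b : ℕ) then (1 : ℝ) else 0)

/-! ### An atom at an all-giant layer is DEC at every target -/

/-- the low part and the absorber part of the atom. -/
theorem atomLaw_split (x T : ℝ) (j l₁ h₁ l₂ h₂ : ℕ) (b : ℕ) :
    atomLaw x T j l₁ h₁ l₂ h₂ b =
      (1 - x) / (usage x T j l₁ h₁ - usage x T j l₂ h₂) *
          ((x / (1 - x) - usage x T j l₂ h₂) * 𝟙[b, l₁] + (usage x T j l₁ h₁ - x / (1 - x)) * 𝟙[b, l₂])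
        + (1 - x) / (usage x T j l₁ h₁ - usage x T j l₂ h₂) *
          ((x / (1 - x) - usage x T j l₂ h₂) * usage x T j l₁ h₁ * 𝟙[b, h₁]
            + (usage x T j l₁ h₁ - x / (1 - x)) * usage x T j l₂ h₂ * 𝟙[b, h₂]) := by
  unfold atomLaw; ring

/-- a range sum of an indicator. -/
theorem sum_range_ind_le_one (n p : ℕ) : ∑ b ∈ Finset.range n, 𝟙[b, p] ≤ 1 := by
  rw [Finset.sum_ite_eq' (Finset.range n) p (fun _ => (1 : ℝ))]
  split_ifs <;> norm_num

/-- a range sum of an indicator at a member. -/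
theorem sum_range_ind_eq_one (n p : ℕ) (hp : p < n) : ∑ b ∈ Finset.range n, 𝟙[b, p] = 1 := by
  rw [Finset.sum_ite_eq' (Finset.range n) p (fun _ => (1 : ℝ)), if_pos (Finset.mem_range.2 hp)]

/-- an `Ico` sum of an indicator at a member. -/
theorem sum_Ico_ind_eq_one (a n p : ℕ) (hp : p < n) (ha : a ≤ p) : ∑ b ∈ Finset.Ico a n, 𝟙[b, p] = 1 := by
  rw [Finset.sum_ite_eq' (Finset.Ico a n) p (fun _ => (1 : ℝ)), if_pos (Finset.mem_Ico.2 ⟨ha, hp⟩)]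

/-- **AN ATOM AT A LAYER BELOW BOTH ITS ABSORBERS IS DEC AT EVERY TARGET `T′ ≥ T`**: there every absorber is a giant, the lows carry `1 − x`, the
giants `x = u·(1 − x)` (`decAtT_iff_of_noMid`).  This is census-1 g21's "trivial side" mechanism for the explicit atom: in giant mode a Type I atom
(and a Type II atom below its lower absorber) reads at ANY raised target. [this work] -/
theorem atomLaw_decAtT_allGiant (x T T' : ℝ) (j M J l₁ h₁ l₂ h₂ : ℕ) (hx0 : 0 < x) (hx1 : x < 1) (hd : AtomData x T j M l₁ h₁ l₂ h₂)
    (hTT : T ≤ T') (hJ1 : J < h₁) (hJ2 : J < h₂) : DECAtT x T' J M (atomLaw x T j l₁ h₁ l₂ h₂) := by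
  classical
  obtain ⟨hl1, hl2⟩ := hd.lt_of
  have hd' := hd
  obtain ⟨a1, a2, a3, a4, a5, b1, b2, b3, b4, b5, hne, c2, c1⟩ := hd'
  have hc₂ : 0 ≤ usage x T j l₂ h₂ := (usage_pos_of_compat x T j l₂ h₂ hx0 hx1 b2 hl2 (Or.inr b5)).le
  have hcc : usage x T j l₁ h₁ ≠ usage x T j l₂ h₂ := ne_of_gt (c2.trans c1)
  have h1x : 0 < 1 - x := by linarith
  have hu : 0 < x / (1 - x) := div_pos hx0 h1x
  set K := (1 - x) / (usage x T j l₁ h₁ - usage x T j l₂ h₂) with hK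
  have hKpos : 0 < K := div_pos h1x (by linarith)
  have hμ0 : ∀ b, 0 ≤ atomLaw x T j l₁ h₁ l₂ h₂ b := atomLaw_nonneg x T j l₁ h₁ l₂ h₂ hx1 hc₂ c2 c1
  have hμM : ∀ b, M < b → atomLaw x T j l₁ h₁ l₂ h₂ b = 0 := fun b hb =>
    atomLaw_eq_zero_of_gt x T j l₁ h₁ l₂ h₂ (by omega) a4 (by omega) b4 hb
  have hμ1 := sum_range_atomLaw x T j l₁ h₁ l₂ h₂ hx1 hcc (show l₁ ≤ M by omega) a4 (show l₂ ≤ M by omega) b4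
  -- no mid carries mass at layer `J`
  have hno : ∀ h, h ≤ J → T' ≤ 2 * (h : ℝ) → atomLaw x T j l₁ h₁ l₂ h₂ h = 0 := by
    intro h hhJ hTh
    refine atomLaw_eq_zero x T j l₁ h₁ l₂ h₂ ?_ (by omega) ?_ (by omega)
    · rintro rfl; linarith
    · rintro rfl; linarith
  rw [decAtT_iff_of_noMid x T' J M _ hx0 hx1 hμ0 hμM hμ1 hno]
  -- low side ≤ u·(1 − x) = x ≤ giant side
  have low_le : ∑ l ∈ (Finset.range (J + 1)).filter (fun l : ℕ => 2 * (l : ℝ) < T'), atomLaw x T j l₁ h₁ l₂ h₂ l ≤ 1 - x := by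
    calc ∑ l ∈ (Finset.range (J + 1)).filter (fun l : ℕ => 2 * (l : ℝ) < T'), atomLaw x T j l₁ h₁ l₂ h₂ l
        ≤ ∑ l ∈ Finset.range (J + 1), atomLaw x T j l₁ h₁ l₂ h₂ l :=
          Finset.sum_le_sum_of_subset_of_nonneg (Finset.filter_subset _ _) (fun l _ _ => hμ0 l)
      _ = ∑ l ∈ Finset.range (J + 1), K * ((x / (1 - x) - usage x T j l₂ h₂) * 𝟙[l, l₁] + (usage x T j l₁ h₁ - x / (1 - x)) * 𝟙[l, l₂]) := by
          refine Finset.sum_congr rfl fun l hl => ?_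
          have hlJ : l < J + 1 := Finset.mem_range.1 hl
          rw [atomLaw_split, ← hK, if_neg (show l ≠ h₁ by omega), if_neg (show l ≠ h₂ by omega)]
          ring
      _ ≤ 1 - x := by
          rw [← Finset.mul_sum, Finset.sum_add_distrib, ← Finset.mul_sum, ← Finset.mul_sum]
          have h1 := sum_range_ind_le_one (J + 1) l₁
          have h2 := sum_range_ind_le_one (J + 1) l₂
          have hle : K * ((x / (1 - x) - usage x T j l₂ h₂) * ∑ b ∈ Finset.range (J + 1), 𝟙[b, l₁]
                + (usage x T j l₁ h₁ - x / (1 - x)) * ∑ b ∈ Finset.range (J + 1), 𝟙[b, l₂])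
              ≤ K * ((x / (1 - x) - usage x T j l₂ h₂) * 1 + (usage x T j l₁ h₁ - x / (1 - x)) * 1) :=
            mul_le_mul_of_nonneg_left (add_le_add (mul_le_mul_of_nonneg_left h1 (by linarith))
              (mul_le_mul_of_nonneg_left h2 (by linarith))) hKpos.le
          have e : K * ((x / (1 - x) - usage x T j l₂ h₂) * 1 + (usage x T j l₁ h₁ - x / (1 - x)) * 1) = 1 - x := by
            rw [hK]; field_simp; ring
          linarith
  have giant_ge : x ≤ ∑ h ∈ Finset.Ico (J + 1) (M + 1), atomLaw x T j l₁ h₁ l₂ h₂ h := by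
    calc x = ∑ h ∈ Finset.Ico (J + 1) (M + 1), K * ((x / (1 - x) - usage x T j l₂ h₂) * usage x T j l₁ h₁ * 𝟙[h, h₁]
            + (usage x T j l₁ h₁ - x / (1 - x)) * usage x T j l₂ h₂ * 𝟙[h, h₂]) := by
          rw [← Finset.mul_sum, Finset.sum_add_distrib, ← Finset.mul_sum, ← Finset.mul_sum,
            sum_Ico_ind_eq_one _ _ _ (Nat.lt_succ_of_le a4) (by omega), sum_Ico_ind_eq_one _ _ _ (Nat.lt_succ_of_le b4) (by omega)]
          rw [hK]; field_simp; ring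
      _ ≤ ∑ h ∈ Finset.Ico (J + 1) (M + 1), atomLaw x T j l₁ h₁ l₂ h₂ h := by
          refine Finset.sum_le_sum fun h hh => ?_
          rw [atomLaw_split x T j l₁ h₁ l₂ h₂ h, ← hK]
          have : 0 ≤ K * ((x / (1 - x) - usage x T j l₂ h₂) * 𝟙[h, l₁] + (usage x T j l₁ h₁ - x / (1 - x)) * 𝟙[h, l₂]) := by
            refine mul_nonneg hKpos.le (add_nonneg (mul_nonneg (by linarith) ?_) (mul_nonneg (by linarith) ?_)) <;>
              split_ifs <;> norm_num
          linarith
  have e : x / (1 - x) * (1 - x) = x := by field_simp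
  calc x / (1 - x) * ∑ l ∈ (Finset.range (J + 1)).filter (fun l : ℕ => 2 * (l : ℝ) < T'), atomLaw x T j l₁ h₁ l₂ h₂ l
      ≤ x / (1 - x) * (1 - x) := mul_le_mul_of_nonneg_left low_le hu.le
    _ = x := e
    _ ≤ _ := giant_ge

/-! ### The trivial side -/

/-- **THE TRIVIAL SIDE OF THE EXPLICIT RESIDUE.**  For admissible data on both sides with the second atom window-DEC on `[j − M₁, j]` and its
absorbers ordered (`h₂′ ≤ h₂`, as in `ConvClosedTAtomsOrd`): if the cheap low `l₁′` of the first atom is NOT DEEP w.r.t. the second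
(`j < l₁′ + h₂′`: at the layer `j − l₁′` both absorbers of the second atom are giants), then the light slice of side 1 is DEC —
`shift_lightPair_decAtT_of_higherTarget` (census-1 g21) with the raised-target reading `atomLaw_decAtT_allGiant` — and so is the convolution
(`lconv_atomLaw_decAtT_of_lightSlice`).  By symmetry (`lconv_comm`) the same when `j < l₂′ + h₁′`; what is left of `ConvClosedTAtomsOrd` is the
DOUBLY DEEP family `l₁′ + h₂′ ≤ j ∧ l₂′ + h₁′ ≤ j` (census-1 g21: 245 / 387 residue pairs at M ≤ 5). [this work] -/
theorem lconv_atoms_decAtT_of_not_deep (x T₁ T₂ : ℝ) (M₁ M₂ j : ℕ) (l₁ h₁ l₁' h₁' l₂ h₂ l₂' h₂' : ℕ)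
    (hx0 : 0 < x) (hx1 : x < 1)
    (hd₁ : AtomData x T₁ j M₁ l₁ h₁ l₁' h₁') (hd₂ : AtomData x T₂ j M₂ l₂ h₂ l₂' h₂') (ho₂ : h₂' ≤ h₂)
    (hw₂ : ∀ j'', j'' ≤ j → j ≤ j'' + M₁ → DECAtT x T₂ j'' M₂ (atomLaw x T₂ j l₂ h₂ l₂' h₂'))
    (hnd : j < l₁' + h₂') :
    DECAtT x (T₁ + T₂) j (M₁ + M₂) (lconv M₁ M₂ (atomLaw x T₁ j l₁ h₁ l₁' h₁') (atomLaw x T₂ j l₂ h₂ l₂' h₂')) := by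
  classical
  obtain ⟨-, hl1'⟩ := hd₁.lt_of
  obtain ⟨hl2, hl2'⟩ := hd₂.lt_of
  have hd₁' := hd₁
  obtain ⟨-, -, -, -, -, p1, p2, p3, p4, p5, -, -, -⟩ := hd₁'
  have hd₂' := hd₂
  obtain ⟨a1, a2, a3, a4, a5, b1, b2, b3, b4, b5, hne, c2, c1⟩ := hd₂'
  -- the second atom is a probability law on `{0..M₂}`
  have hc₂ : 0 ≤ usage x T₂ j l₂' h₂' := (usage_pos_of_compat x T₂ j l₂' h₂' hx0 hx1 b2 hl2' (Or.inr b5)).le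
  have hcc : usage x T₂ j l₂ h₂ ≠ usage x T₂ j l₂' h₂' := ne_of_gt (c2.trans c1)
  have n2 : ∀ b, 0 ≤ atomLaw x T₂ j l₂ h₂ l₂' h₂' b := atomLaw_nonneg x T₂ j l₂ h₂ l₂' h₂' hx1 hc₂ c2 c1
  have z2 : ∀ b, M₂ < b → atomLaw x T₂ j l₂ h₂ l₂' h₂' b = 0 := fun b hb =>
    atomLaw_eq_zero_of_gt x T₂ j l₂ h₂ l₂' h₂' (by omega) a4 (by omega) b4 hb
  have s2 := sum_range_atomLaw x T₂ j l₂ h₂ l₂' h₂' hx1 hcc (show l₂ ≤ M₂ by omega) a4 (show l₂' ≤ M₂ by omega) b4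
  refine lconv_atomLaw_decAtT_of_lightSlice x T₁ T₂ j M₁ M₂ l₁ h₁ l₁' h₁' _ hx0 hx1 hd₁ n2 z2 s2 hw₂ ?_
  -- the light slice as a mixture of two shifts of the second atom
  set γ := gateOf x T₁ j l₁' h₁' with hγ
  obtain ⟨hg0, hg1⟩ := gateOf_bounds x T₁ j l₁' h₁' hx0 hx1 p2 p3 p5
  have hl1'M : l₁' ≤ M₁ := by omega
  have e : lconv M₁ M₂ (fun b => TP[l₁', h₁', γ, b]) (atomLaw x T₂ j l₂ h₂ l₂' h₂')
      = fun h => (1 - γ) * SH[atomLaw x T₂ j l₂ h₂ l₂' h₂', l₁', h] + γ * SH[atomLaw x T₂ j l₂ h₂ l₂' h₂', h₁', h] := by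
    funext h
    rw [lconv_comm, lconv_TP M₂ M₁ l₁' h₁' _ γ z2 hl1'M p4]
  rw [e]
  have h := shift_lightPair_decAtT_of_higherTarget x T₂ T₁ γ j M₂ M₁ l₁' h₁' (atomLaw x T₂ j l₂ h₂ l₂' h₂') hx0 hx1 n2 z2 s2
    hl1'.le p4 ⟨by nlinarith, hg1.le⟩ (fun hlj => ?_) (fun hhj => hw₂ (j - h₁') (Nat.sub_le _ _) (by omega)) (Or.inl (by linarith))
  · rw [add_comm T₂ T₁, add_comm M₂ M₁] at h
    exact h
  · -- the raised target at the layer `j − l₁′`: both absorbers of the second atom are giants there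
    have e2 : T₂ + T₁ - 2 * (l₁' : ℝ) = T₂ + (T₁ - 2 * (l₁' : ℝ)) := by ring
    rw [e2]
    exact atomLaw_decAtT_allGiant x T₂ (T₂ + (T₁ - 2 * (l₁' : ℝ))) j M₂ (j - l₁') l₂ h₂ l₂' h₂' hx0 hx1 hd₂ (by linarith)
      (by omega) (by omega)

/-- **the mirror trivial side**: the cheap low of the SECOND atom is not deep w.r.t. the first. [this work] -/
theorem lconv_atoms_decAtT_of_not_deep' (x T₁ T₂ : ℝ) (M₁ M₂ j : ℕ) (l₁ h₁ l₁' h₁' l₂ h₂ l₂' h₂' : ℕ)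
    (hx0 : 0 < x) (hx1 : x < 1)
    (hd₁ : AtomData x T₁ j M₁ l₁ h₁ l₁' h₁') (hd₂ : AtomData x T₂ j M₂ l₂ h₂ l₂' h₂') (ho₁ : h₁' ≤ h₁)
    (hw₁ : ∀ j'', j'' ≤ j → j ≤ j'' + M₂ → DECAtT x T₁ j'' M₁ (atomLaw x T₁ j l₁ h₁ l₁' h₁'))
    (hnd : j < l₂' + h₁') :
    DECAtT x (T₁ + T₂) j (M₁ + M₂) (lconv M₁ M₂ (atomLaw x T₁ j l₁ h₁ l₁' h₁') (atomLaw x T₂ j l₂ h₂ l₂' h₂')) := by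
  have h := lconv_atoms_decAtT_of_not_deep x T₂ T₁ M₂ M₁ j l₂ h₂ l₂' h₂' l₁ h₁ l₁' h₁' hx0 hx1 hd₂ hd₁ ho₁ hw₁ hnd
  rw [add_comm T₂ T₁, add_comm M₂ M₁, ← lconv_comm] at h
  exact h

end LawDec

end Quant

end Summit.CriticalPhenomena.PercolationContinuityZ3.Theorems
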